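import Summits.NavierStokesRegularity.NavierStokesRegularity.Theses.CertifiedBlowup
import Summits.NavierStokesRegularity.NavierStokesRegularity.Theorems.CertifiedBlowupRefutations

/-!
# Route `CertifiedBlowup`: the v1 thesis (item `stmt-NavierStokesRegularity-0268`) carries no
content beyond Clay-class uniqueness

Item `stmt-NavierStokesRegularity-0268` (`certifiedBlowup_thesis`, support; informal only — the
route file `Theses/CertifiedBlowup.lean` carries no Lean statement for it) reads
`X := (∃ d : Literature.NS.BlowupProfileData, Literature.NS.BlowupProfileConditions d) ∧ X5b`,
with `X5b` = `BlowupClayUniqueness` (item `stmt-NavierStokesRegularity-0153`) verbatim.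
With the definitions that landed (`Theorems/CertifiedBlowupConditions.lean`) the package
`BlowupProfileConditions d F` takes the analytic frame `F : StabilityFrame d` as a second
argument, so `BlowupProfileConditions d` is a predicate on frames, not a proposition, and the only
well-typed readings of the first conjunct quantify the frame. This file settles both:

* existential frame (`certifiedBlowupThesisV1_exists_iff`): the conjunct is inhabited by the junk
  frame of `Literature.NS.exists_blowupProfileConditions_junk`, so the thesis is *equivalent* to
  `BlowupClayUniqueness` alone — item 0153 in disguise;
* universal frame (`not_forall_frame_blowupProfileConditions`, `certifiedBlowupThesisV1_forall_false`):
  for every datum some frame violates the residual bound (i), so the conjunct — and the thesis — is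
  *false* outright.

Either way 0268 does not feed the deciding theorem `closes` (hypotheses `CertifiedBlowupAxisymBlowup`,
`BlowupClayUniqueness`) and is superseded by `CertifiedBlowupThesisV2` (item 0725), as the route text
says; an honest certificate conjunct needs the canonical frame `nsFrame d` (not yet defined).
-/

-- single-conjunct summit: `Summit.<Summit>.<Problem>` repeats the name by convention (D-0017)
set_option linter.dupNamespace false

namespace Summit.NavierStokesRegularity.NavierStokesRegularity.Theorems

open Summit.NavierStokesRegularity.NavierStokesRegularity.Theses.CertifiedBlowup
open Literature.NS

/-- **v1 thesis, existential-frame reading, is exactly Clay-class uniqueness.**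
`((∃ d F, BlowupProfileConditions d F) ∧ BlowupClayUniqueness) ↔ BlowupClayUniqueness`: the
certificate conjunct is inhabited by the junk frame
(`Literature.NS.exists_blowupProfileConditions_junk`), so it constrains nothing. Audit lemma for
item stmt-NavierStokesRegularity-0268. [folklore] -/
theorem certifiedBlowupThesisV1_exists_iff :
    ((∃ d : BlowupProfileData, ∃ F : StabilityFrame d, BlowupProfileConditions d F) ∧
        BlowupClayUniqueness) ↔ BlowupClayUniqueness := by
  refine ⟨And.right, fun hU => ⟨?_, hU⟩⟩
  obtain ⟨d, -, -, -, -, -, F, hF⟩ := exists_blowupProfileConditions_junk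
  exact ⟨d, F, hF⟩

/-- **No datum passes in every frame.** For every `d` the one-dimensional frame `X = ℝ` with
residual `|ε| + 1` (`ε = d.residualBound`) violates the residual bound (i) `‖residual‖ ≤ ε`, so
`∀ F, BlowupProfileConditions d F` fails. Audit lemma for item stmt-NavierStokesRegularity-0268
(universal-frame reading). [folklore] -/
theorem not_forall_frame_blowupProfileConditions (d : BlowupProfileData) :
    ¬ ∀ F : StabilityFrame d, BlowupProfileConditions d F := by
  intro h
  let F : StabilityFrame d :=
    { X := ℝ, reconstruct := fun _ => 0, residual := |(d.residualBound : ℝ)| + 1,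
      linForm := fun _ => 0, nonlinForms := [] }
  have h1 : ‖(|(d.residualBound : ℝ)| + 1 : ℝ)‖ ≤ (d.residualBound : ℝ) := (h F).residual_le
  rw [Real.norm_of_nonneg (by positivity)] at h1
  linarith [le_abs_self (d.residualBound : ℝ)]

/-- **v1 thesis, universal-frame reading, is false.**
`¬ ((∃ d, ∀ F, BlowupProfileConditions d F) ∧ BlowupClayUniqueness)`, by
`not_forall_frame_blowupProfileConditions`. Audit lemma for item stmt-NavierStokesRegularity-0268.
[folklore] -/
theorem certifiedBlowupThesisV1_forall_false :
    ¬ ((∃ d : BlowupProfileData, ∀ F : StabilityFrame d, BlowupProfileConditions d F) ∧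
        BlowupClayUniqueness) :=
  fun h => h.1.elim fun d hd => not_forall_frame_blowupProfileConditions d hd

end Summit.NavierStokesRegularity.NavierStokesRegularity.Theorems
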